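import Mathlib
import HarnessLib
import Literature.RingTheory.MvPolynomial.IteratedDerivations

/-!
# [CP-II] ch.1 II.5.3.2 (i) / [CP 2019] Lemma 6.3 and Thm 3.6: order at a closed point modulo `p`-th powers —
# what is dimension-free (`ord ≤ 1 + deg`) and what is one-transverse-parameter only (`ord ≤ 1 + deg/d`)

Sources. [CP-II] V. Cossart, O. Piltant, *Resolution of singularities of threefolds in positive
characteristic II*, J. Algebra 321 (2009) 1836–1976, chapter 1, II.5.3.2 (printed p. 1862; proof p. 1863),
read from the HAL author version hal-00139445v2 (manuscript pp. 28–29 = PDF pp. 29–30, per-page text files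
`p0029`, `p0030`). [CP 2019] V. Cossart, O. Piltant, *Resolution of singularities of arithmetical threefolds*,
J. Algebra 529 (2019) 268–535, read from arXiv:1412.0868v1 ("… Arithmetical Threefolds II"); ALL theorem /
section numbers of [CP 2019] below are those of arXiv v1 (§2.5 "Adapted differential structure", Notation 3.3,
Theorem 3.6 = the blowing-up theorem, Lemma 6.3), the journal numbering was not collated. This module belongs
to the DIM-4 CENSUS of the cell (OBSTRUCTIONS-DIM4.md §34–§35): it separates, at kernel level, the part of the
II.5.3.2 estimate that holds for ANY number of transverse residual parameters from the part that is specific to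
ONE transverse parameter, and refutes the verbatim two-parameter transcription by an explicit closed point.
Caveat: AI-typed reproduction; not refereed by a human.

VERBATIM, [CP-II] II.5.3.2 (ms p. 28; the cell's earlier transcriptions "e ≤ di + 1" flattened the printed
fraction — the proof on ms p. 29, eq. (4), reads "e ≤ 1 + ord_v F_D(1, U₃/U₂) ≤ 1 + deg F_D / d = 1 + i/d",
and "note the trivial fact that 1 + i/d ≤ i whenever (i, d ≥ 2)"). "II.5.3.2 Theorem. Let F(U₂,U₃) ∈
k(x₀)[U₂,U₃] be a homogeneous polynomial of degree i ≥ 0, and a, b ∈ ℕ be such that U₂ᵃU₃ᵇF(U₂,U₃) ∉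
(k(x₀)[U₂,U₃])ᵖ. Let x′ ∈ Spec k(x₀)[U₃/U₂] be a closed point with ideal (v := P(1, U₃/U₂)), P ∈ k(x₀)[U₂,U₃]
a nonzero homogeneous irreducible polynomial of degree d := [k(x′) : k(x₀)], unitary in U₃. Let A ∈ T′ :=
k(x₀)[U₂, U₃/U₂]_{(U₂,v)} be such that U₂^{a+b+i} (resp. U₂^{a+b+i}vᵇ) divides Aᵖ in T′ if P ≠ U₃ (resp.
P = U₃). There exists an integer e ≥ 0 such that U₂^{a+b+i}(U₃/U₂)ᵇF(1, U₃/U₂) + Aᵖ ≡ U₂^{a+b+i}(U₃/U₂)ᵇ γ vᵉ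
mod (U₂^{a+b+i+1}T′), (1) with γ invertible in T′. We have the following estimates for e: (i) if P ≠ U₃ (resp.
P = U₃), we have e ≤ i/d + 1 (resp. e ≤ i); (ii) if P ≠ U₃, then e < p(1 + ⌊i/(pd)⌋) …; (iii) if i ≥ 1 and
b = 0, then e ≤ i; (iv) if i ≥ 2 and b = 0, there exists at most one x′ as above with e = i. … In particular,
x′ is rational over x₀." PROOF MECHANISM (ms p. 29): "there exists a derivation D ∈ Der_{k₀}(k(x₀)[U₂,U₃]),
D preserving degrees of homogeneous polynomials, such that D(U₂ᵃU₃ᵇF) = U₂ᵃU₃ᵇF_D, with F_D ≠ 0 … D ∈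
{U₂∂/∂U₂, U₃∂/∂U₃, {∂/∂λᵢ}_{4≤i≤s}}" (λᵢ from a p-basis of k(x₀)/k₀, conventions II.3); D kills Aᵖ; Case 1:
"e ≤ ord_{x′} F_D(1,U₃/U₂) ≤ deg F_D/d = i/d"; Case 2 (D′ = ∂/∂v): "e ≤ 1 + ord_v F_D(1,U₃/U₂) ≤ 1 + deg F_D/d =
1 + i/d (4)". [cite: CossartPiltant2009, ch.1 II.5.3.2, J. Algebra 321 p. 1862-1863 = HAL ms p. 28-29]

VERBATIM, [CP 2019] Lemma 6.3 (arXiv v1 §6 "Maximal contact, resolution of κ(x) = 1"; "All proofs are based on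
the following elementary lemma"): "Let (R, 𝔪, k) be a regular local ring of dimension two, 𝔪 = (v₁,v₂),
char k = p > 0. Let f ∈ R with initial form in_𝔪 f = V₁^{a₁}V₂^{a₂}F(V₁,V₂) ∈ G(𝔪), in_𝔪 f ∉ G(𝔪)ᵖ. Let
furthermore P(t) ∈ R[t] be monic of degree d ≥ 1 with irreducible residue P̄(t) ∈ k[t], R′ := R[v₂/v₁]_{(v₁,v′₂)},
v′₂ := P(v₂/v₁) and define: a′ := max_{g′∈R′}{ord_{v₁}(f − g′ᵖ)}, e′ := max_{g′∈R′}{ord_{v̄′₂}(v₁^{−a′}(f − g′ᵖ))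
: ord_{v₁}(f − g′ᵖ) = a′}. The following hold: (1) a′ = a₁ + a₂, e′ ≤ 1 + ⌊deg F/d⌋; if equality holds, then
deg F/d ∈ ℕ, a′/p ∈ ℕ, e′/p ∉ ℕ, and J(in_𝔪 f, div(v₁v₂), 𝔪) = ⟨(V₁ᵈP(V₂/V₁))^{deg F/d}⟩; (2) if a₂ = 0,
then e′ ≤ max{deg F, 1}. Equality holds only if deg F ≤ 1 or d = 1. Proof. Identical to [CoP2] II.5.3.2 on
p. 1862. Note that it is not necessary to assume R excellent." — i.e. even in 2019 the estimate is printed for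
a regular local ring of dimension TWO: one exceptional parameter `v₁` and ONE transverse parameter `v₂`.
[cite: CossartPiltant2019, Lemma 6.3 (arXiv:1412.0868v1)]

IN PRINT FOR ANY NUMBER OF TRANSVERSE PARAMETERS (statement level, [CP 2019] chapters 2–3, "any dimension
n = dim S"). §2.5: "Let (λ_l)_{l∈Λ₀} be an absolute p-basis of S/m_S … The corresponding derivations
(∂/∂λ_l)_{l∈Λ₀} … will be usually called 'derivations w.r.t. to constants'. Let D(W) ⊂ Der(Ĝ(W)) be the
submodule generated by the derivations w.r.t. to constants together with ({U_j∂/∂U_j}_{j∈J_E}, {∂/∂U_j}_{j∈J∖J_E},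
{ū_{j′}∂/∂ū_{j′}}_{j′∈(J′)_E}, {∂/∂ū_{j′}}_{j′∈J′∖(J′)_E}) … for F ∈ G(W), there is an equivalence: ∀ D ∈ D(W),
D·F = 0 ⇔ F ∈ G(W)ᵖ", and `𝒥(F,E,W) := cl_d(D_W · F)`. Notation 3.3: `S̄′ := Ô_{σ⁻¹(m_S),s′} =
Ŝ′/(u, {u_{j′}}) = completion of k(x)[{U_j/U}_{j∈J}] at m̄′`, "m̄′ denotes the ideal of the restriction of s′ to
σ⁻¹(m_S)" — the closed point `s′` of the projective fibre, of ANY residue degree, with the set `F` of transverse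
parameters of any size — and `ord̄ I′ := ord_{m̄′} I′S̄′`. Theorem 3.6 (proof): "Note that derivatives in D_{W′}
decrease orders by at most one. Since H_{W′} is the initial form of H(x′) in G(W′), we have: ε(x′) ≤
min{ord_{m_{S′/(u)}}(H_{W′}⁻¹G_{W′}ᵖ), 1 + ord_{m_{S′/(u)}} J(F_{p,Z′,W′},E′,W′)}"; "Since D·Θ′ᵖ = 0 for every
D ∈ D_{W′}, we deduce … J(F_{p,Z′,W′},E′,W′) ≡ J(F_{p,X′,W′},E′,W′) mod …" (independence of the `p`-th power
correction `Θ′ᵖ`, the rôle of `+Aᵖ` in II.5.3.2); "We deduce that ord̄ I′ ≤ ω(x) and s′ ∉ PC(x,𝒴) ⟹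
ord̄ I′ < ω(x)"; "We have proved that ε(x′) ≤ 1 + ord̄ I′ ≤ 1 + ω(x)". Numerically this is the bound
"order ≤ 1 + degree" at a closed point of any residue degree — enough for the NON-increase of
`(m, ω, κ ∈ {1, ≥ 2})` in every dimension (census row O5), not for a STRICT drop at non-rational points, which
is what the `1/d` of II.5.3.2 (i) delivers ([CP-I] Lemma 4.5 (25) ⇒ β′ ≤ (β+1)/2 < β, kernel:
`NearPointPolygon.endgame_25`; [CP 2019] §6 Prop. 6.4 "β(x′) ≤ 1 + ⌊C(x)/d⌋"). [cite: CossartPiltant2019,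
§2.5, Notation 3.3, Theorem 3.6 proof (arXiv:1412.0868v1)]

WHAT THIS MODULE TYPES (polynomial cores; `k` any field, `char k = p` where stated; "order of `G` along an
ideal `I` ≥ e" is written `G ∈ I ^ e`, so no new definition is introduced).
* `derivation_apply_mem_pow` — "derivatives decrease orders by at most one": for ANY derivation `D` of a
  commutative ring and any ideal `I`, `x ∈ I^{n+1} ⇒ D x ∈ Iⁿ` (Leibniz + induction);
  `derivation_apply_pow_char` — `D(aᵖ) = 0` in characteristic `p`; `derivation_apply_mem_pow_of_add_pow_mem` —
  `F + aᵖ ∈ I^{n+1} ⇒ D F ∈ Iⁿ` (the `Θ′ᵖ`/`Aᵖ`-independence).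
* `not_mem_pow_succ_totalDegree` — **order ≤ degree at EVERY proper ideal** of `k[w_σ]` (`σ` arbitrary, `I ≠ ⊤`
  arbitrary — in particular every closed point of `𝔸^m_k` of every residue degree, separable or not):
  `G ≠ 0 ⇒ G ∉ I^{deg G + 1}`. Proof (folklore, written to avoid the Nullstellensatz): base-change to
  `K := k[w]/I`, where `I` acquires the tautological `K`-point `a = (w̄ᵢ)`, so `I·K[w] ⊆ 𝔪_a`; translate by `a`
  (`Literature.RingTheory.MvPolynomial.shift`) into the ideal of the origin, whose `n`-th power only contains
  polynomials all of whose monomials have degree `≥ n` (`degree_le_of_mem_pow_ker_eval_zero`); the translate has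
  total degree `≤ deg G` (`totalDegree_shift_le`), so it vanishes, and translation and base change are injective.
* `add_pow_not_mem_pow`, `add_pow_not_mem_pow_totalDegree` — the DIMENSION-FREE form of II.5.3.2 (i) / of the
  Theorem 3.6 mechanism: if some derivation `D` (over any base ring: coordinate derivations `∂/∂w_j` over `k`, or
  derivations "w.r.t. constants" over `ℤ`) has `D F ≠ 0`, then for every proper ideal `I` and every `A`:
  `F + Aᵖ ∉ I^{deg(DF) + 2}` ("e ≤ 1 + ord F_D ≤ 1 + deg F_D"), hence `∉ I^{deg F + 2}` when `deg DF ≤ deg F`.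
* `mul_natDegree_le_of_mem_span_pow`, `mul_natDegree_le_of_add_pow_mem` — ONE transverse parameter (`k[w]`,
  closed point `(P)`, `d = deg P`): `G ∈ (P)ᵉ ⇒ e·d ≤ deg G` ((22)(ii) of [CP-I] Lemma 4.5 / Case 1), and the
  kernel form of Case 2 of II.5.3.2 (i): `P` prime, `S ∉ (P)` (denominator of `A = B/S ∈ k[w]_{(P)}`), `D F ≠ 0`,
  `F·Sᵖ + Bᵖ ∈ (P)^{e+1}` `⇒ e·d ≤ deg(D F)` — i.e. `ord ≤ 1 + deg(F_D)/d`.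
* The WITNESS (§34 of the census, upgraded to the "modulo p-th powers" setting and kernel-checked): `Q ∈ k[T]`
  irreducible of degree `d ≥ 2`, `𝔪 := (w₂, Q(w₃)) ⊂ k[w₂,w₃]` — `isMaximal` (a closed point `x′` of `𝔸²_k`, via
  `ker_aeval_root_eq`: `𝔪 = ker(w₂ ↦ 0, w₃ ↦ θ)` onto `k(θ) = k[T]/(Q)`), `finrank_residueField`
  (`[k(x′):k] = d`), `X0_pow_mem_pow` / `X0_pow_not_mem_pow_succ` (the order of `w₂ⁱ` at `x′` is EXACTLY `i`:
  map to `k(θ)[w₂]`, where `𝔪 ↦ (w₂)`), `one_add_div_lt` (`1 + i/d < i` for `i ≥ 3`), `pderiv_X0_pow` (`p ∤ i ⇒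
  ∂(w₂ⁱ)/∂w₂ ≠ 0` of degree `i − 1`: the hypothesis "not a p-th power" holds and the dimension-free bound is
  attained), `two_parameter_sharp_bound_fails` (conjunction), and a concrete instance over `𝔽₂`
  (`Q = T² + T + 1`, `i = 3`).

DIMENSION (the census statement this module supports; OBSTRUCTIONS-DIM4 §35). With ONE transverse residual
parameter (regular threefold, `τ = 1`, point blow-up, a chart of the exceptional `ℙ²` meeting the strict
transform of `div(z)` in `ℙ¹`) closed points are principal, `(v) = (P(1,u))`, and the order at `x′` of a form of
degree `i` is `≤ i/d`, `d = [k(x′):k(x)]` — the source of the STRICT decrease at non-rational very near points.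
With TWO transverse parameters (regular fourfold) the closed points of `𝔸²_{k(x)}` are height-two maximal ideals
and only `order ≤ degree` survives (`not_mem_pow_succ_totalDegree`, attained at `(w₂, Q(w₃))` by `w₂ⁱ`); this is
exactly the form used by [CP 2019] Theorem 3.6 in every dimension, and exactly too weak for [CP-I] Lemma 4.5 (2)
one dimension up. No several-transverse-parameter sharpening is printed ([CP-II] II.5.3.2 and [CP 2019] Lemma 6.3
are two-dimensional statements; [CJS 2020] Thm 3.10 treats arbitrary `k(x′)/k(x)` only for Hilbert–Samuel
functions, by Hironaka's monogenic base change; Benito–Villamayor (Indiana Univ. Math. J. 64 (2015),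
arXiv:1103.3462, §1 and 1.18) call the behaviour of the analogous `H-ord` "rather untraceable" and bound it between
two upper semicontinuous functions instead).

NOT TYPED: the graded-algebra / completion setting (`G(W)`, `Ŝ′`, `cl_d`), the existence of a derivation w.r.t.
constants detecting a non-`p`-th power (p-basis calculus over an imperfect field — the derivation is a
HYPOTHESIS `D F ≠ 0` here, as it is an explicit choice from a list in the printed proof), estimates (ii)–(iv)
of II.5.3.2, and everything scheme-theoretic in Theorem 3.6.
-/

namespace Literature.AlgebraicGeometry.CossartPiltant200819.OrderAtClosedPoint

open MvPolynomial
open Literature.RingTheory.MvPolynomial (shift shift_X shift_injective eval_shift totalDegree_shift_le)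

/-! ### Derivations lower orders along an ideal by at most one, and kill `p`-th powers -/

section Derivations

variable {R A : Type*} [CommRing R] [CommRing A] [Algebra R A]

/-- "Note that derivatives in `D_{W′}` decrease orders by at most one" — for ANY derivation `D` of a commutative
ring and any ideal `I`: `x ∈ I^{n+1} ⇒ D x ∈ Iⁿ` (Leibniz rule and induction on `n`).
[cite: CossartPiltant2019, Theorem 3.6 proof (arXiv:1412.0868v1 §3.2)] [folklore] -/
theorem derivation_apply_mem_pow (D : Derivation R A A) (I : Ideal A) :
    ∀ (n : ℕ) {x : A}, x ∈ I ^ (n + 1) → D x ∈ I ^ n := by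
  intro n
  induction n with
  | zero => intro x _; simp
  | succ n ih =>
    intro x hx
    rw [pow_succ'] at hx
    refine Submodule.mul_induction_on hx ?_ ?_
    · intro a ha b hb
      rw [Derivation.leibniz, pow_succ', smul_eq_mul, smul_eq_mul]
      refine Ideal.add_mem _ (Ideal.mul_mem_mul ha (ih hb)) ?_
      have hb' : b ∈ I * I ^ n := by rw [← pow_succ']; exact hb
      exact Ideal.mul_mem_right _ _ hb'
    · intro x y hx hy
      rw [map_add]
      exact Ideal.add_mem _ hx hy

/-- In characteristic `p` every derivation kills `p`-th powers: `D(aᵖ) = p·a^{p−1}·Da = 0`. [folklore] -/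
theorem derivation_apply_pow_char (p : ℕ) [CharP A p] (D : Derivation R A A) (a : A) :
    D (a ^ p) = 0 := by
  rw [Derivation.leibniz_pow, nsmul_eq_mul, CharP.cast_eq_zero, zero_mul]

/-- The `p`-th power correction is invisible to derivations: `F + aᵖ ∈ I^{n+1} ⇒ D F ∈ Iⁿ` ("Since
`D·Θ′ᵖ = 0` for every `D ∈ D_{W′}`, we deduce … `J(F_{p,Z′,W′},E′,W′) ≡ J(F_{p,X′,W′},E′,W′)`"; in II.5.3.2:
`D((U₃/U₂)ᵇF(1,U₃/U₂) + Aᵖ/U₂^{a+b+i}) = u·(U₃/U₂)ᵇF_D(1,U₃/U₂)`, eq. (3) of the proof).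
[cite: CossartPiltant2019, Theorem 3.6 proof (arXiv:1412.0868v1)] [cite: CossartPiltant2009, ch.1 II.5.3.2
proof eq. (3), HAL ms p. 29] -/
theorem derivation_apply_mem_pow_of_add_pow_mem (p : ℕ) [CharP A p] (D : Derivation R A A)
    (I : Ideal A) (n : ℕ) {F a : A} (h : F + a ^ p ∈ I ^ (n + 1)) : D F ∈ I ^ n := by
  have := derivation_apply_mem_pow D I n h
  rwa [map_add, derivation_apply_pow_char, add_zero] at this

end Derivations

/-! ### The order of a polynomial along any proper ideal is at most its degree -/

section OrderLeDegree

variable {σ : Type*}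

/-- Elements of the `n`-th power of the ideal of the origin `ker(eval 0) ⊂ K[w_σ]` (`K` any commutative ring)
have no monomial of degree `< n`. [folklore] -/
theorem degree_le_of_mem_pow_ker_eval_zero {K : Type*} [CommRing K] :
    ∀ (n : ℕ) {P : MvPolynomial σ K}, P ∈ RingHom.ker (eval (0 : σ → K)) ^ n →
      ∀ m ∈ P.support, n ≤ Finsupp.degree m := by
  classical
  intro n
  induction n with
  | zero => intro P _ m _; exact Nat.zero_le _
  | succ n ih =>
    intro P hP
    rw [pow_succ'] at hP
    refine Submodule.mul_induction_on hP ?_ ?_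
    · intro a ha b hb m hm
      have hsub := support_mul a b hm
      obtain ⟨m₁, hm₁, m₂, hm₂, rfl⟩ := Finset.mem_add.mp hsub
      have h1 : 1 ≤ Finsupp.degree m₁ := by
        rw [Nat.one_le_iff_ne_zero, Ne, Finsupp.degree_eq_zero_iff]
        rintro rfl
        rw [RingHom.mem_ker, eval_zero] at ha
        exact (mem_support_iff.mp hm₁) ha
      have h2 := ih hb m₂ hm₂
      rw [map_add]
      omega
    · intro x y hx hy m hm
      rcases Finset.mem_union.mp (support_add hm) with h | h
      · exact hx m h
      · exact hy m h

variable {k : Type*} [Field k]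

/-- Mapping along an injective coefficient map preserves the total degree. [folklore] -/
theorem totalDegree_map_of_injective {S : Type*} [CommSemiring S] {f : k →+* S}
    (hf : Function.Injective f) (G : MvPolynomial σ k) : (map f G).totalDegree = G.totalDegree := by
  simp only [totalDegree, support_map_of_injective G hf]

/-- **Order ≤ degree at every proper ideal.** A nonzero polynomial `G` over a field does not lie in
`I ^ (deg G + 1)` for any proper ideal `I` of `k[w_σ]` (`σ` arbitrary); in particular its order at any closed
point of `𝔸^σ_k` (maximal ideal, of any residue degree, separable or not) is at most its total degree. This is
the inequality behind "We deduce that `ord̄ I′ ≤ ω(x)`" in the proof of [CP 2019] Theorem 3.6 (the localisation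
at the closed point `s′ ∈ σ⁻¹(m_S)` of an ideal generated by forms of degree `ω(x)` has order `≤ ω(x)`), valid
for any number of transverse parameters. Proof: base change to `K = k[w]/I` (tautological `K`-point), translation
to the origin, `degree_le_of_mem_pow_ker_eval_zero`, degree count. [folklore]
[cite: CossartPiltant2019, Theorem 3.6 proof, "ord̄ I′ ≤ ω(x)" (arXiv:1412.0868v1)] -/
theorem not_mem_pow_succ_totalDegree (I : Ideal (MvPolynomial σ k)) (hI : I ≠ ⊤)
    {G : MvPolynomial σ k} (hG : G ≠ 0) : G ∉ I ^ (G.totalDegree + 1) := by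
  classical
  intro hmem
  haveI : Nontrivial (MvPolynomial σ k ⧸ I) := Ideal.Quotient.nontrivial_iff.mpr hI
  set K := MvPolynomial σ k ⧸ I with hK
  let ι : k →+* K := (Ideal.Quotient.mk I).comp (C : k →+* MvPolynomial σ k)
  have hι : Function.Injective ι := ι.injective
  let a : σ → K := fun i => Ideal.Quotient.mk I (X i)
  have hcomp : (eval a).comp (map ι) = Ideal.Quotient.mk I := by
    apply ringHom_ext
    · intro r; simp [ι]
    · intro i; simp [a]
  have heval : ∀ f : MvPolynomial σ k, eval a (map ι f) = Ideal.Quotient.mk I f :=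
    fun f => RingHom.congr_fun hcomp f
  set d := G.totalDegree with hd
  have h1 : map ι G ∈ (Ideal.map (map ι) I) ^ (d + 1) := by
    rw [← Ideal.map_pow]; exact Ideal.mem_map_of_mem _ hmem
  have hle : Ideal.map (map ι) I ≤ RingHom.ker (eval a) := by
    rw [Ideal.map_le_iff_le_comap]
    intro f hf
    rw [Ideal.mem_comap, RingHom.mem_ker, heval, Ideal.Quotient.eq_zero_iff_mem]
    exact hf
  have h2 : map ι G ∈ (RingHom.ker (eval a)) ^ (d + 1) := Ideal.pow_right_mono hle _ h1
  have hle' : Ideal.map (shift a) (RingHom.ker (eval a)) ≤ RingHom.ker (eval (0 : σ → K)) := by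
    rw [Ideal.map_le_iff_le_comap]
    intro f hf
    rw [RingHom.mem_ker] at hf
    rw [Ideal.mem_comap, RingHom.mem_ker, eval_shift, zero_add]
    exact hf
  have h3 : shift a (map ι G) ∈ (RingHom.ker (eval (0 : σ → K))) ^ (d + 1) := by
    refine Ideal.pow_right_mono hle' _ ?_
    rw [← Ideal.map_pow]; exact Ideal.mem_map_of_mem _ h2
  have hdeg : (shift a (map ι G)).totalDegree ≤ d :=
    (totalDegree_shift_le a _).trans (totalDegree_map_of_injective hι G).le
  have hQ : shift a (map ι G) = 0 := by
    by_contra hQ0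
    obtain ⟨m, hm⟩ := Finset.nonempty_iff_ne_empty.mpr (mt support_eq_empty.mp hQ0)
    have hge := degree_le_of_mem_pow_ker_eval_zero (d + 1) h3 m hm
    have hle2 : Finsupp.degree m ≤ (shift a (map ι G)).totalDegree := by
      rw [Finsupp.degree_apply]; exact le_totalDegree hm
    omega
  have hmap : map ι G = 0 := shift_injective a (by rw [hQ, map_zero])
  exact hG (map_injective ι hι (by rw [hmap, map_zero]))

/-- **The dimension-free form of [CP-II] II.5.3.2 (i) / of the [CP 2019] Theorem 3.6 mechanism**
("`ε(x′) ≤ 1 + ord J(F)`", "`e ≤ 1 + ord_{x′} F_D`"; ANY number of transverse parameters, ANY proper ideal,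
in particular any closed point of any residue degree): if a derivation `D` of `k[w_σ]` (over any base ring —
`∂/∂w_j` over `k`, or a derivation "w.r.t. constants" over `ℤ`) has `D F ≠ 0`, then for every `A`,
`F + Aᵖ ∉ I^{deg(D F) + 2}`. [cite: CossartPiltant2019, Theorem 3.6 proof, "ε(x′) ≤ min{…, 1 + ord
J(F_{p,Z′,W′},E′,W′)}" and "ε(x′) ≤ 1 + ord̄ I′ ≤ 1 + ω(x)" (arXiv:1412.0868v1)] [cite: CossartPiltant2009,
ch.1 II.5.3.2 (i) proof, Cases 1–2, HAL ms p. 29] -/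
theorem add_pow_not_mem_pow (p : ℕ) [CharP k p] {R : Type*} [CommRing R]
    [Algebra R (MvPolynomial σ k)] (D : Derivation R (MvPolynomial σ k) (MvPolynomial σ k))
    (I : Ideal (MvPolynomial σ k)) (hI : I ≠ ⊤) {F : MvPolynomial σ k} (hDF : D F ≠ 0)
    (A : MvPolynomial σ k) : F + A ^ p ∉ I ^ ((D F).totalDegree + 2) := by
  intro h
  exact not_mem_pow_succ_totalDegree I hI hDF (derivation_apply_mem_pow_of_add_pow_mem p D I _ h)

/-- Same, in terms of `deg F` when `D` does not raise degrees: `F + Aᵖ ∉ I^{deg F + 2}` — "`e ≤ 1 + i`", the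
bound that survives with several transverse parameters (and is attained there: `two_parameter_sharp_bound_fails`).
[cite: CossartPiltant2019, Theorem 3.6 proof (arXiv:1412.0868v1)] -/
theorem add_pow_not_mem_pow_totalDegree (p : ℕ) [CharP k p] {R : Type*} [CommRing R]
    [Algebra R (MvPolynomial σ k)] (D : Derivation R (MvPolynomial σ k) (MvPolynomial σ k))
    (I : Ideal (MvPolynomial σ k)) (hI : I ≠ ⊤) {F : MvPolynomial σ k} (hDF : D F ≠ 0)
    (hdeg : (D F).totalDegree ≤ F.totalDegree) (A : MvPolynomial σ k) :
    F + A ^ p ∉ I ^ (F.totalDegree + 2) := fun h =>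
  add_pow_not_mem_pow p D I hI hDF A (Ideal.pow_le_pow_right (by omega) h)

end OrderLeDegree


/-! ### One transverse parameter: the sharp bound of II.5.3.2 (i) ("`e ≤ 1 + i/d`") -/

section OneParameter

variable {k : Type*} [Field k]

/-- (22)(ii) of [CP-I] Lemma 4.5 / Case 1 of the proof of II.5.3.2: in ONE variable the order at the
closed point `(P)`, `deg P = d`, is at most `deg G / d`: `G ∈ (P)^e`, `G ≠ 0` `⇒ e·d ≤ deg G`.
(Cf. `NearPointPolygon.mul_natDegree_le_of_pow_dvd`, the same fact in divisibility form.)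
[cite: CossartPiltant2009, ch.1 II.5.3.2 (p. 1862) proof, Case 1, HAL ms p. 29] [cite: CossartPiltant2008,
Lemma 4.5 proof eq. (22), HAL p. 13] -/
theorem mul_natDegree_le_of_mem_span_pow {P G : Polynomial k} (hG : G ≠ 0) {e : ℕ}
    (h : G ∈ Ideal.span {P} ^ e) : e * P.natDegree ≤ G.natDegree := by
  rw [Ideal.span_singleton_pow, Ideal.mem_span_singleton] at h
  rw [← Polynomial.natDegree_pow]
  exact Polynomial.natDegree_le_of_dvd h hG

/-- **II.5.3.2 (i), one transverse parameter, kernel form of Case 2** ("`e ≤ 1 + ord_v F_D ≤ 1 + i/d`"):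
let `P` be prime (the closed point `x′ = (v)`, `v = P`, `d = deg P = [k(x′):k(x₀)]`), `D` any derivation,
`S ∉ (P)` (a denominator of `A = B/S ∈ k[w]_{(P)}`). If `F·S^p + B^p ∈ (P)^{e+1}` and `D F ≠ 0` then
`e·d ≤ deg (D F)`; with `deg (D F) ≤ deg F = i` this is `e + 1 ≤ 1 + ⌊i/d⌋ + 1`, i.e. the printed
`ord ≤ 1 + i/d`. [cite: CossartPiltant2009, ch.1 II.5.3.2 (i), J. Algebra 321 p. 1862 = HAL ms p. 28; proof
Case 2, eq. (4), HAL ms p. 29] [cite: CossartPiltant2019, Lemma 6.3 (1) (arXiv:1412.0868v1 §6): "e′ ≤ 1 + ⌊deg F/d⌋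
… Proof. Identical to [CoP2] II.5.3.2 on p. 1862"] -/
theorem mul_natDegree_le_of_add_pow_mem (p : ℕ) [CharP k p] {R : Type*} [CommRing R]
    [Algebra R (Polynomial k)] (D : Derivation R (Polynomial k) (Polynomial k)) {P : Polynomial k}
    (hP : Prime P) {F S B : Polynomial k} (hS : ¬ P ∣ S) (hDF : D F ≠ 0) {e : ℕ}
    (h : F * S ^ p + B ^ p ∈ Ideal.span {P} ^ (e + 1)) : e * P.natDegree ≤ (D F).natDegree := by
  have h1 := derivation_apply_mem_pow_of_add_pow_mem p D _ e h
  have h2 : D (F * S ^ p) = S ^ p * D F := by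
    rw [Derivation.leibniz, derivation_apply_pow_char, smul_zero, zero_add, smul_eq_mul]
  rw [h2, Ideal.span_singleton_pow, Ideal.mem_span_singleton] at h1
  have h3 : P ^ e ∣ D F :=
    hP.pow_dvd_of_dvd_mul_left e (fun h' => hS (hP.dvd_of_dvd_pow h')) h1
  rw [← Polynomial.natDegree_pow]
  exact Polynomial.natDegree_le_of_dvd h3 hDF

end OneParameter

/-! ### The witness: at a non-rational closed point of `𝔸²` the bound with `1/[k(x′):k(x)]` fails -/

section Witness

variable {k : Type*} [Field k] (Q : Polynomial k)

/- Throughout this section the closed point is `x′ = V(w₂, Q(w₃)) ∈ 𝔸²_k` with maximal ideal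
`𝔪 = (w₂, Q(w₃)) = Ideal.span {X 0, Polynomial.aeval (X 1) Q}` (`X 0 = w₂`, `X 1 = w₃`); it is written out in
full in every statement (no notation is introduced). -/

/-- Killing `w₂`: `f − f(0, w₃) ∈ (w₂)`. [folklore] -/
theorem sub_aeval_zero_mem_span_X0 (f : MvPolynomial (Fin 2) k) :
    f - MvPolynomial.aeval ![(0 : MvPolynomial (Fin 2) k), X 1] f ∈
      Ideal.span {(X 0 : MvPolynomial (Fin 2) k)} := by
  induction f using MvPolynomial.induction_on with
  | C r => simp
  | add p q hp hq =>
    have : p + q - MvPolynomial.aeval ![(0 : MvPolynomial (Fin 2) k), X 1] (p + q)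
        = (p - MvPolynomial.aeval ![(0 : MvPolynomial (Fin 2) k), X 1] p)
          + (q - MvPolynomial.aeval ![(0 : MvPolynomial (Fin 2) k), X 1] q) := by
      rw [map_add]; ring
    rw [this]; exact Ideal.add_mem _ hp hq
  | mul_X p i hp =>
    have hi : i = 0 ∨ i = 1 := by
      rcases i with ⟨i, hi⟩
      rcases i with _ | i
      · exact Or.inl rfl
      · rcases i with _ | i
        · exact Or.inr rfl
        · omega
    rcases hi with rfl | rfl
    · have : p * X 0 - MvPolynomial.aeval ![(0 : MvPolynomial (Fin 2) k), X 1] (p * X 0)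
          = p * X 0 := by simp
      rw [this]; exact Ideal.mul_mem_left _ _ (Ideal.subset_span rfl)
    · have : p * X 1 - MvPolynomial.aeval ![(0 : MvPolynomial (Fin 2) k), X 1] (p * X 1)
          = (p - MvPolynomial.aeval ![(0 : MvPolynomial (Fin 2) k), X 1] p) * X 1 := by
        simp; ring
      rw [this]; exact Ideal.mul_mem_right _ _ hp

/-- The restriction `f ↦ f(0, w₃)` factors through `k[w₃]`. [folklore] -/
theorem aeval_X1_aeval_zero_X (f : MvPolynomial (Fin 2) k) :
    Polynomial.aeval (X 1 : MvPolynomial (Fin 2) k)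
        (MvPolynomial.aeval ![(0 : Polynomial k), Polynomial.X] f)
      = MvPolynomial.aeval ![(0 : MvPolynomial (Fin 2) k), X 1] f := by
  have : (Polynomial.aeval (X 1 : MvPolynomial (Fin 2) k)).comp
      (MvPolynomial.aeval ![(0 : Polynomial k), Polynomial.X])
        = MvPolynomial.aeval ![(0 : MvPolynomial (Fin 2) k), X 1] := by
    apply MvPolynomial.algHom_ext
    intro i
    fin_cases i <;> simp
  exact AlgHom.congr_fun this f

/-- The evaluation `w₂ ↦ 0, w₃ ↦ θ` onto `k(θ) = k[T]/(Q)` is surjective. [folklore] -/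
theorem aeval_root_surjective :
    Function.Surjective
      (MvPolynomial.aeval ![(0 : AdjoinRoot Q), AdjoinRoot.root Q] :
        MvPolynomial (Fin 2) k →ₐ[k] AdjoinRoot Q) := by
  intro x
  induction x using AdjoinRoot.induction_on with
  | ih g =>
    refine ⟨Polynomial.aeval (X 1 : MvPolynomial (Fin 2) k) g, ?_⟩
    rw [← Polynomial.aeval_algHom_apply]
    simp [AdjoinRoot.aeval_eq]

/-- The kernel of `w₂ ↦ 0, w₃ ↦ θ` is exactly `𝔪 = (w₂, Q(w₃))`. [folklore] -/
theorem ker_aeval_root_eq :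
    RingHom.ker (MvPolynomial.aeval ![(0 : AdjoinRoot Q), AdjoinRoot.root Q] :
        MvPolynomial (Fin 2) k →ₐ[k] AdjoinRoot Q)
      = (Ideal.span {(X 0 : MvPolynomial (Fin 2) k), Polynomial.aeval (X 1) Q}) := by
  set ψ := (MvPolynomial.aeval ![(0 : AdjoinRoot Q), AdjoinRoot.root Q] :
        MvPolynomial (Fin 2) k →ₐ[k] AdjoinRoot Q) with hψ
  have hX0 : ψ (X 0) = 0 := by simp [hψ]
  have hX1 : ψ (X 1) = AdjoinRoot.root Q := by simp [hψ]
  have hQ1 : ψ (Polynomial.aeval (X 1 : MvPolynomial (Fin 2) k) Q) = 0 := by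
    rw [← Polynomial.aeval_algHom_apply, hX1, AdjoinRoot.aeval_eq, AdjoinRoot.mk_self]
  apply le_antisymm
  · intro f hf
    rw [RingHom.mem_ker] at hf
    set g := MvPolynomial.aeval ![(0 : Polynomial k), Polynomial.X] f with hg
    have hA := sub_aeval_zero_mem_span_X0 f
    rw [← aeval_X1_aeval_zero_X] at hA
    -- ψ kills (w₂), hence ψ (Q-part) = 0
    have hspan : Ideal.span {(X 0 : MvPolynomial (Fin 2) k)} ≤ RingHom.ker ψ := by
      rw [Ideal.span_le, Set.singleton_subset_iff]; exact hX0
    have hg0 : ψ (Polynomial.aeval (X 1 : MvPolynomial (Fin 2) k) g) = 0 := by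
      have := hspan hA
      rw [RingHom.mem_ker, map_sub, hf, zero_sub, neg_eq_zero] at this
      exact this
    rw [← Polynomial.aeval_algHom_apply, hX1, AdjoinRoot.aeval_eq, AdjoinRoot.mk_eq_zero] at hg0
    obtain ⟨h, hh⟩ := hg0
    have hgm : Polynomial.aeval (X 1 : MvPolynomial (Fin 2) k) g
        ∈ (Ideal.span {(X 0 : MvPolynomial (Fin 2) k), Polynomial.aeval (X 1) Q}) := by
      rw [hh, map_mul]
      exact Ideal.mul_mem_right _ _ (Ideal.subset_span (by simp))
    have hsub : f - Polynomial.aeval (X 1 : MvPolynomial (Fin 2) k) g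
        ∈ (Ideal.span {(X 0 : MvPolynomial (Fin 2) k), Polynomial.aeval (X 1) Q}) :=
      Ideal.span_mono (by simp) hA
    simpa using Ideal.add_mem _ hsub hgm
  · rw [Ideal.span_le]
    intro x hx
    simp only [Set.mem_insert_iff, Set.mem_singleton_iff] at hx
    rcases hx with rfl | rfl
    · exact hX0
    · exact hQ1

/-- `x′ = V(w₂, Q(w₃))` is a closed point: `𝔪` is maximal (`Q` irreducible). [folklore] -/
theorem isMaximal (hQ : Irreducible Q) :
    Ideal.IsMaximal (Ideal.span {(X 0 : MvPolynomial (Fin 2) k), Polynomial.aeval (X 1) Q}) := by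
  haveI := Fact.mk hQ
  rw [← ker_aeval_root_eq Q]
  exact RingHom.ker_isMaximal_of_surjective _ (aeval_root_surjective Q)

/-- Its residue field is `k(x′) ≅ k[T]/(Q)`, of degree `[k(x′) : k] = deg Q`. [folklore] -/
theorem finrank_residueField (hQ0 : Q ≠ 0) :
    Module.finrank k
        (MvPolynomial (Fin 2) k ⧸ (Ideal.span {(X 0 : MvPolynomial (Fin 2) k), Polynomial.aeval (X 1) Q}))
      = Q.natDegree := by
  have e : (MvPolynomial (Fin 2) k ⧸ (Ideal.span {(X 0 : MvPolynomial (Fin 2) k), Polynomial.aeval (X 1) Q}))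
      ≃ₐ[k] AdjoinRoot Q :=
    (Ideal.quotientEquivAlgOfEq k (ker_aeval_root_eq Q).symm).trans
      (Ideal.quotientKerAlgEquivOfSurjective (aeval_root_surjective Q))
  rw [e.toLinearEquiv.finrank_eq, PowerBasis.finrank (AdjoinRoot.powerBasis hQ0),
    AdjoinRoot.powerBasis_dim]

/-- `w₂ⁱ ∈ 𝔪ⁱ`: the order of `w₂ⁱ` at `x′` is at least `i`. [folklore] -/
theorem X0_pow_mem_pow (i : ℕ) :
    (X 0 : MvPolynomial (Fin 2) k) ^ i
      ∈ (Ideal.span {(X 0 : MvPolynomial (Fin 2) k), Polynomial.aeval (X 1) Q}) ^ i :=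
  Ideal.pow_mem_pow (Ideal.subset_span (by simp)) i

/-- `w₂ⁱ ∉ 𝔪^{i+1}`: the order of `w₂ⁱ` at `x′` is EXACTLY `i = deg w₂ⁱ`, although `[k(x′):k] = deg Q ≥ 2`
(map to `k(θ)[w₂]`, `θ` a root of `Q`, under which `𝔪 ↦ (w₂)`). [folklore] -/
theorem X0_pow_not_mem_pow_succ (hQ : Irreducible Q) (i : ℕ) :
    (X 0 : MvPolynomial (Fin 2) k) ^ i
      ∉ (Ideal.span {(X 0 : MvPolynomial (Fin 2) k), Polynomial.aeval (X 1) Q}) ^ (i + 1) := by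
  haveI := Fact.mk hQ
  intro hmem
  set φ := (MvPolynomial.aeval ![(Polynomial.X : Polynomial (AdjoinRoot Q)),
      Polynomial.C (AdjoinRoot.root Q)] :
        MvPolynomial (Fin 2) k →ₐ[k] Polynomial (AdjoinRoot Q)) with hφ
  have hX0 : φ (X 0) = Polynomial.X := by simp [hφ]
  have hQ1 : φ (Polynomial.aeval (X 1 : MvPolynomial (Fin 2) k) Q) = 0 := by
    rw [← Polynomial.aeval_algHom_apply]
    have hX1 : φ (X 1) = algebraMap (AdjoinRoot Q) (Polynomial (AdjoinRoot Q)) (AdjoinRoot.root Q) := by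
      simp [hφ, Polynomial.algebraMap_eq]
    rw [hX1, Polynomial.aeval_algebraMap_apply, AdjoinRoot.aeval_eq, AdjoinRoot.mk_self, map_zero]
  have hle : Ideal.map φ (Ideal.span {(X 0 : MvPolynomial (Fin 2) k), Polynomial.aeval (X 1) Q})
      ≤ Ideal.span {(Polynomial.X : Polynomial (AdjoinRoot Q))} := by
    rw [Ideal.map_span, Ideal.span_le]
    rintro y ⟨x, hx, rfl⟩
    simp only [Set.mem_insert_iff, Set.mem_singleton_iff] at hx
    rcases hx with rfl | rfl
    · rw [hX0]; exact Ideal.subset_span rfl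
    · rw [hQ1]; exact Ideal.zero_mem _
  have h1 : φ ((X 0 : MvPolynomial (Fin 2) k) ^ i)
      ∈ Ideal.span {(Polynomial.X : Polynomial (AdjoinRoot Q))} ^ (i + 1) := by
    refine Ideal.pow_right_mono hle _ ?_
    rw [← Ideal.map_pow]; exact Ideal.mem_map_of_mem _ hmem
  rw [map_pow, hX0, Ideal.span_singleton_pow, Ideal.mem_span_singleton] at h1
  have := (pow_dvd_pow_iff Polynomial.X_ne_zero Polynomial.not_isUnit_X).mp h1
  omega

/-- The arithmetic of the failure: for residue degree `d ≥ 2` and `i ≥ 3`, the order `i` exceeds the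
one-transverse-parameter bound `1 + i/d` of II.5.3.2 (i). [folklore] -/
theorem one_add_div_lt {i d : ℕ} (hi : 3 ≤ i) (hd : 2 ≤ d) : (1 : ℚ) + i / d < i := by
  have hd' : (2 : ℚ) ≤ d := by exact_mod_cast hd
  have hi' : (3 : ℚ) ≤ i := by exact_mod_cast hi
  have hdpos : (0 : ℚ) < d := by linarith
  have h1 : (i : ℚ) / d ≤ i / 2 := div_le_div_of_nonneg_left (by linarith) (by norm_num) hd'
  linarith

/-- The dimension-free bound is attained by the witness: with `D = ∂/∂w₂` and `p ∤ i`, `D(w₂ⁱ) = i·w₂^{i−1} ≠ 0`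
has degree `i − 1`, so `add_pow_not_mem_pow` forbids exactly `𝔪^{i+1}` — and `w₂ⁱ ∈ 𝔪ⁱ`. [folklore] -/
theorem pderiv_X0_pow (p : ℕ) [CharP k p] {i : ℕ} (hi : ¬ p ∣ i) :
    pderiv 0 ((X 0 : MvPolynomial (Fin 2) k) ^ i) ≠ 0 ∧
      (pderiv 0 ((X 0 : MvPolynomial (Fin 2) k) ^ i)).totalDegree + 1 = i := by
  have hi0 : i ≠ 0 := by rintro rfl; exact hi (dvd_zero p)
  have hne : (i : k) ≠ 0 := by
    intro h
    exact hi ((CharP.cast_eq_zero_iff k p i).mp h)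
  have hder : pderiv 0 ((X 0 : MvPolynomial (Fin 2) k) ^ i) = C (i : k) * X 0 ^ (i - 1) := by
    rw [pderiv_pow, pderiv_X_self, mul_one, map_natCast]
  refine ⟨?_, ?_⟩
  · rw [hder]
    exact mul_ne_zero (by rwa [Ne, C_eq_zero]) (pow_ne_zero _ (X_ne_zero _))
  · rw [hder, C_mul_X_pow_eq_monomial, totalDegree_monomial _ hne, Finsupp.sum_single_index rfl]
    omega


/-- **Summary of the witness** (answer to OBSTRUCTIONS-DIM4 §34's typed question, negative half): for every
field `k` admitting an irreducible `Q` of degree `d ≥ 2` and every `i ≥ 3`, at the closed point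
`x′ = V(w₂, Q(w₃))` of `𝔸²_k` (two transverse parameters, `[k(x′):k] = d`) the form `F = U₂^i` has order
EXACTLY `i` at `x′` (with `A = 0`), while the verbatim two-parameter transcription of II.5.3.2 (i) would demand
`order ≤ 1 + i/d < i`. If moreover `p ∤ i`, `F` is not killed by `∂/∂w₂` (so it is not a `p`-th power and the
hypothesis of II.5.3.2 holds) and the dimension-free bound `add_pow_not_mem_pow` (`order ≤ 1 + deg ∂F/∂w₂ = i`)
is attained. (The statement refuted here is NOT printed anywhere: II.5.3.2 and Lemma 6.3 are stated for ONE
transverse parameter; this is the census's own probe of the verbatim lift.) [folklore] -/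
theorem two_parameter_sharp_bound_fails (hQ : Irreducible Q) (hd : 2 ≤ Q.natDegree) {i : ℕ} (hi : 3 ≤ i) :
    Ideal.IsMaximal (Ideal.span {(X 0 : MvPolynomial (Fin 2) k), Polynomial.aeval (X 1) Q}) ∧
      Module.finrank k
          (MvPolynomial (Fin 2) k ⧸ (Ideal.span {(X 0 : MvPolynomial (Fin 2) k), Polynomial.aeval (X 1) Q}))
        = Q.natDegree ∧
      (X 0 : MvPolynomial (Fin 2) k) ^ i
        ∈ (Ideal.span {(X 0 : MvPolynomial (Fin 2) k), Polynomial.aeval (X 1) Q}) ^ i ∧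
      (X 0 : MvPolynomial (Fin 2) k) ^ i
        ∉ (Ideal.span {(X 0 : MvPolynomial (Fin 2) k), Polynomial.aeval (X 1) Q}) ^ (i + 1) ∧
      (1 : ℚ) + i / Q.natDegree < i :=
  ⟨isMaximal Q hQ, finrank_residueField Q hQ.ne_zero, X0_pow_mem_pow Q i,
    X0_pow_not_mem_pow_succ Q hQ i, one_add_div_lt hi hd⟩

/-- A concrete instance in characteristic `2`: `k = 𝔽₂`, `Q = T² + T + 1`, `x′ = V(w₂, w₃² + w₃ + 1) ∈ 𝔸²_{𝔽₂}`
(`[k(x′):k] = 2`), `F = U₂³` (`2 ∤ 3`): order `3 > 1 + 3/2`. [folklore] -/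
example :
    let Q : Polynomial (ZMod 2) := Polynomial.X ^ 2 + Polynomial.X + 1
    let M : Ideal (MvPolynomial (Fin 2) (ZMod 2)) :=
      Ideal.span {X 0, Polynomial.aeval (X 1 : MvPolynomial (Fin 2) (ZMod 2)) Q}
    M.IsMaximal ∧ Module.finrank (ZMod 2) (MvPolynomial (Fin 2) (ZMod 2) ⧸ M) = 2 ∧
      (X 0 : MvPolynomial (Fin 2) (ZMod 2)) ^ 3 ∈ M ^ 3 ∧
      (X 0 : MvPolynomial (Fin 2) (ZMod 2)) ^ 3 ∉ M ^ 4 ∧ (1 : ℚ) + 3 / 2 < 3 ∧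
      pderiv 0 ((X 0 : MvPolynomial (Fin 2) (ZMod 2)) ^ 3) ≠ 0 := by
  intro Q M
  have hdeg : Q.natDegree = 2 := by
    show (Polynomial.X ^ 2 + Polynomial.X + 1 : Polynomial (ZMod 2)).natDegree = 2
    compute_degree!
  have hQ : Irreducible Q := by
    refine Polynomial.irreducible_of_degree_le_three_of_not_isRoot (by rw [hdeg]; decide) ?_
    intro x
    have : ∀ a : ZMod 2, a ^ 2 + a + 1 ≠ 0 := by decide
    simpa [Q, Polynomial.IsRoot] using this x
  obtain ⟨h1, h2, h3, h4, h5⟩ := two_parameter_sharp_bound_fails Q hQ (by rw [hdeg]) (le_refl 3)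
  rw [hdeg] at h2 h5
  refine ⟨h1, h2, h3, h4, by exact_mod_cast h5, (pderiv_X0_pow (k := ZMod 2) 2 (i := 3) (by decide)).1⟩

end Witness

end Literature.AlgebraicGeometry.CossartPiltant200819.OrderAtClosedPoint
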